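import Summits.ResolutionOfSingularities.ResolutionOfSingularities.Theorems.HilbertSamuelEliminationCampaignW42NearFibreOfDirDimEq
import HarnessLib

/-!
# [OURS · L1 W4.2] The `e = ē` door in the exact BINDER SHAPE of the near-fibre binders of chain w42 — F-61
# `Thm314_nearFibre_subsingleton` / `Moving.Theorem314_nearFibre_geomDir` with the characteristic clause replaced by
# `e_x(X) = ē_x(X)`, PROVED, plus the rationality companion (campaign s42, cell res-hironaka; informal crux `RidgeConfinement`,
# stmt-ResolutionOfSingularities-17845; consumers in crux chain w42, stmt-ResolutionOfSingularities-19249; `--supports`)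

HONEST FRAMING. OURS (slot W4.2, prover res-L1-s42-pv-1, gen 4). Companion of `…CampaignW42Theorem314BinderShapes` (p526960).
The near-fibre binders of chain w42 — the print fact F-61 `Thm314_nearFibre_subsingleton` (`∀ X X' π D, IsExcellent X →
IsPermissible D → IsBlowup π D → ∀ N, dim X ≤ N → ∀ x ∈ V(D), CharHypothesis X x → e_x(X) ≤ dim 𝒪_{D,x} + 1 → {near fibre}.Subsingleton`)
and its (F1♯) form `Moving.Theorem314_nearFibre_geomDir` (same with `GeomDirHypothesis X x`) — share one binder list. This file
states and PROVES the twin with the characteristic clause replaced by CJS's (F3) clause `Scheme.dirDim X x = Scheme.geomDirDim X x`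
(all other binders in the same order; `dim X ≤ N` accepted and unused), from `nearFibre_subsingleton_and_isIso_of_dirDim_eq_geomDirDim`
(p527976), together with the rationality companion in the same shape. Fact-free, every characteristic. NOTHING here is a statement
of H. Hironaka's manuscript [Hironaka2017]. AI review is weaker than expert review. References (orientation only): V. Cossart,
U. Jannsen, S. Saito, LNM 2270 (2020), Thm. 3.14, p. 103 L32, §6.3 (F3).
-/

noncomputable section

-- single-conjunct summit: the doubled namespace component `ResolutionOfSingularities` is mandated
set_option linter.dupNamespace false

open CategoryTheory AlgebraicGeometry TopologicalSpace IsLocalRing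
open Literature.AlgebraicGeometry.Resolution Literature.RingTheory.HilbertSamuel
open Literature.AlgebraicGeometry.CossartJannsenSaito2020

namespace Summit.ResolutionOfSingularities.ResolutionOfSingularities.Theorems

namespace CampaignW42

universe u

/-- **F-61 / `Moving.Theorem314_nearFibre_geomDir` with the characteristic clause replaced by `e_x(X) = ē_x(X)`, PROVED**:
for `X` excellent, `D` permissible, `π` a blow-up in `D`, `N` (with the unused binder `dim X ≤ N`), `x ∈ V(D)` with
`e_x(X) = ē_x(X)` and `e_x(X) ≤ dim 𝒪_{D,x} + 1`: the points over `x` near to `x` form a subsingleton.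
[cite: CossartJannsenSaito2020, Thm. 3.14, §6.3 (F3)] -/
theorem thm314_nearFibre_shape_of_dirDim_eq_geomDirDim :
    ∀ (X X' : Scheme.{u}) [IsLocallyNoetherian X] (π : X' ⟶ X) (D : X.IdealSheafData),
      Scheme.IsExcellent X → IdealSheafData.IsPermissible D → IsBlowup π D →
        ∀ N : ℕ, topologicalKrullDim X ≤ (N : WithBot ℕ∞) →
          ∀ x : X, x ∈ D.support → Scheme.dirDim X x = Scheme.geomDirDim X x →
            (Scheme.dirDim X x : WithBot ℕ∞) ≤ ringKrullDim (X.presheaf.stalk x ⧸ stalkIdeal D x) + 1 →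
              {x' : X' | π.base x' = x ∧ Scheme.hsFun X' N x' = Scheme.hsFun X N x}.Subsingleton := by
  intro X X' _ π D hX hD hπ N _ x hxD heq he
  exact (nearFibre_subsingleton_and_isIso_of_dirDim_eq_geomDirDim π D hX hD hπ N x hxD heq he).1

/-- **The rationality companion in the same binder shape**: under the same hypotheses, at a point `x'` over `x` near to `x`
the residue field map `κ(x) → κ(x')` is an isomorphism (CJS p. 103 L32 «`k(y) = k(x)`», general centre).
[cite: CossartJannsenSaito2020, Thm. 3.14, p. 103 L32] -/
theorem isIso_residueFieldMap_nearFibre_shape_of_dirDim_eq_geomDirDim :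
    ∀ (X X' : Scheme.{u}) [IsLocallyNoetherian X] (π : X' ⟶ X) (D : X.IdealSheafData),
      Scheme.IsExcellent X → IdealSheafData.IsPermissible D → IsBlowup π D →
        ∀ N : ℕ, topologicalKrullDim X ≤ (N : WithBot ℕ∞) →
          ∀ x : X, x ∈ D.support → Scheme.dirDim X x = Scheme.geomDirDim X x →
            (Scheme.dirDim X x : WithBot ℕ∞) ≤ ringKrullDim (X.presheaf.stalk x ⧸ stalkIdeal D x) + 1 →
              ∀ x' : X', π.base x' = x → Scheme.hsFun X' N x' = Scheme.hsFun X N x → IsIso (π.residueFieldMap x') := by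
  intro X X' _ π D hX hD hπ N _ x hxD heq he
  exact (nearFibre_subsingleton_and_isIso_of_dirDim_eq_geomDirDim π D hX hD hπ N x hxD heq he).2

end CampaignW42

end Summit.ResolutionOfSingularities.ResolutionOfSingularities.Theorems

end
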